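import Literature.MathematicalPhysics.QuantumFieldTheory.Balaban1983to89.B15Prop1LocalLettersSU2Box
import Literature.MathematicalPhysics.QuantumFieldTheory.Balaban1983to89.B15Prop1ChartRecentering

/-!
# `Balaban1983to89.B15Prop1LocalLettersRecord` — [Balaban1989LargeFieldI] Prop. 1 p. 194 / [Balaban1989LargeFieldII] pp. 357–359: THE N12∕s1
# CHAIN RE-THREADED WITH LOCAL LETTERS, LAYERS 5–10 — (1.67) by name, print's instance `InstOn.std` over (181), Proposition 4 [15],
# `H* := H†`, the domain constant chosen, (c3) derived, the differentiability letter in print's coordinates — THE LOCAL ENDPOINT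
# `exists_domain_prop1Printed_lfVarOn_std_su2_box_of_differentiableAt_local`: every per-`V_k` datum letter asked only at REGULAR `V_k`,
# `hA`∕`hG` only on the ball `‖B′‖ ≤ r`

statement-level skeleton of published theorems with citation tags; proofs where landed; nothing here is a claim about
the Yang–Mills mass gap

Cell pub-ymgap, HUMAN RULING D-0062 (Track A full width), seat `pub-ymgap-dag-n12-c` (R134 acceleration seat (a), strategy s1 of DAG node
N12 = [B15]; generation g4, eighth product; SELF-AUDIT TS-LETTERS-GLOBAL, pub-ymgap INBOX 2026-08-27 ≈04:09Z — see the header of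
`B15Prop1LocalLettersModel` for the located point and the shape of the repair).

WHAT THIS FILE PROVES (no `sorry`, no definition, no `… : Prop` fact; axioms standard): the localized twins of `B15Prop1SliceIneq167.
prop1Printed_lfVarOn_su2_box_G0_of_167` (p482614), `B15Prop1StdInstanceSU2Box.prop1Printed_lfVarOn_std_su2_box` (p483252),
`B15Prop1LipschitzFromProp4.prop1Printed_lfVarOn_std_su2_box_of_prop4` (p484186), `B15Prop1AdjointOfRecord.prop1Printed_lfVarOn_std_su2_box_adjoint`
∕ `exists_domain_prop1Printed_lfVarOn_std_su2_box` (p485420), `B15Prop1CriticalAtBoxG0.exists_domain_prop1Printed_lfVarOn_std_su2_box_of_fderiv`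
(p494166) and `B15Prop1ChartRecentering.exists_domain_prop1Printed_lfVarOn_std_su2_box_of_differentiableAt` (p495693) — the `…_local` theorems
below, with the abstract regularity predicate `Rg : ∀ i, GaugeField P (k i) SU2 → Prop`, its bridge `hRg : ∀ i ε Vk, 0 < ε → ε ≤ eR i →
PlaqSmallOn (plaqsInside (pts (k i) (Z i ∩ (Λ i)ᶜ))) ε Vk → Rg i Vk` (print's regularity *«|∂V_k − 1| < ε on Z ∩ Λᶜ»*), the per-`V_k` letters
`hlead`, `hH`(∕`hHst`), `hdV0`∕`hdV` → `hW`, premised on `Rg i Vk`, and `hA`, `hc3` → `hF` → `hG` premised on `Rg i Vk` and `‖B‖ ≤ r i`.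

★★ THE LOCAL ENDPOINT `exists_domain_prop1Printed_lfVarOn_std_su2_box_of_differentiableAt_local` and ★★★ its instance
`exists_domain_prop1Printed_lfVarOn_std_su2_box_regular` (`Rg := eR`-regularity of print, bridge discharged): `∃ a₁ > 0, B15.Prop1Printed (lfVarOn su2Chart
(InstOn.std bg M₁ Z Λ k M a₁ An))` from letters that speak ONLY of ε-regular boundary data (`ε ≤ eR`) and of print's function
`B′ ↦ A(U_{k,Z}(exp(iB′)Ṽ_k))` on the ball `‖B′‖ ≤ r ≤ 1/2` — the shape NODE 00 can instantiate.

HONEST SCOPE.  Count-neutral; nothing retracted (the landed global-letter theorems are the `Rg := ⊤` special case); NOT a discharge of N12;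
nothing continuum ∕ OS ∕ mass-gap ∕ Clay.
-/

noncomputable section

open Set Finset
open scoped BigOperators Matrix RealInnerProductSpace Real

namespace Literature.MathematicalPhysics.QuantumFieldTheory.Balaban1983to89.B15Prop1LocalLettersRecord

open B15DeterminingSets GaugeField B16Sect1Backgrounds B15Prop1Carrier B8Eq17ClassAkV1
open B15Prop1CarrierOnSU2Box B15Prop1SliceIneq18 B15Prop1CarrierOnSU2BoxIneq19 B15Prop1CarrierOnSU2BoxExt193 B15Prop1SliceIneq167
open B15Prop1StdInstanceSU2Box B15Prop1LipschitzFromProp4 B15Prop1AdjointOfRecord B15Prop1CriticalViaSlice B15Prop1ChartCalculusSU2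
open B15Prop1CriticalAtBoxG0 B15Prop1ChartRecentering B15Prop1LocalLettersModel B15Prop1LocalLettersSU2Box
open T4CubeChartGnomonic (SU2)
open B15Prop1ChartSU2 (su2Chart)
open B15Prop1SliceCoordinates (GaugeSlice ιA freeBonds norm_ιA_apply_le)
open T4AxialGaugeSmallField (castSite castSite_apply castSite_add_e castSite_injOn_box boxPlaqs)
open T4AxialGaugeFixing (TreeOrder boxDepth)
open B7Prop1Explicit (e e_apply)
open B6BondElimination (unitVec unitVec_apply)
open B6TreeGaugePoincare (curl)
open B16Eq18Proof (box mem_box)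
open B15Extension193 (extend)
open B15ShellGauge193 (shellGauge)
open B5Prop11Plancherel (Tor shiftM fdiff)
open B5Bounds167Lattice (d1Sq formDk ofRealCfg ineq167)
open B14.Eq213DetSet B14.Eq216Concrete B14.Eq12InteriorLocality B15Sect1Instances B15Eq177GaugeInvariance
open Literature.MathematicalPhysics.QuantumFieldTheory.BalabanImbrieJaffe1984to88.BIJ85Eq453GaugeField
open B11Prop6Scheme (Prop4Hyp)
open B16Prop1IVFromProp4 (dV_zero_of_prop4Hyp lipschitz_of_prop4Hyp)

/-! ## §1 Layer 5: (1.67) consumed by name (local) -/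

section Generic

variable {P : Params}

/-- **LOCAL twin of `B15Prop1SliceIneq167.prop1Printed_lfVarOn_su2_box_G0_of_167`** (`hlead` asked at regular `V_k`).
[cite: Balaban1989LargeFieldI, Prop. 1 (1.77)–(1.78) p.194; Balaban1989LargeFieldII, p.357, (1.7)–(1.9) p.358, pp.358–359; Balaban1984PropagatorsI, (1.67) p.29] -/
theorem prop1Printed_lfVarOn_su2_box_G0_of_167_local (hd3 : 3 ≤ P.d) (h0 : 0 < P.d) {ι : Type} (I : ι → InstOn P SU2)
    (Rg : ∀ i, GaugeField P (I i).k SU2 → Prop)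
    [∀ i, DecidableEq (PBond P (I i).k)]
    (T : ∀ i, Finset (PBond P (I i).k))
    {F : ι → Type*} [∀ i, NormedAddCommGroup (F i)] [∀ i, InnerProductSpace ℝ (F i)]
    (H : ∀ i, GaugeField P (I i).k SU2 →
      (GaugeSlice (pts (I i).k (I i).Λ) (T i) (EuclideanSpace ℝ (Fin 3)) →ₗ[ℝ] F i))
    (Hst : ∀ i, GaugeField P (I i).k SU2 →
      (F i →ₗ[ℝ] GaugeSlice (pts (I i).k (I i).Λ) (T i) (EuclideanSpace ℝ (Fin 3))))
    (hadj : ∀ i Vk (x : GaugeSlice (pts (I i).k (I i).Λ) (T i) (EuclideanSpace ℝ (Fin 3))) (y : F i),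
      ⟪H i Vk x, y⟫ = ⟪x, Hst i Vk y⟫)
    (Δ₁ : ∀ i, GaugeField P (I i).k SU2 → (F i →ₗ[ℝ] F i)) (dV : ∀ i, GaugeField P (I i).k SU2 → F i → F i)
    (J : ∀ i, GaugeField P (I i).k SU2 → F i)
    (lo hi : ι → Fin P.d → ℤ) (n : ι → ℕ) (hn : ∀ i κ, hi i κ ≤ lo i κ + n i) (hN : ∀ i, n i + 2 < P.sitesPerDir (I i).k)
    (hbox : ∀ i, pts (I i).k (I i).Λ = (castSite '' Set.Icc (lo i) (hi i) : Set (Site P (I i).k)))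
    (hZ : ∀ i, (boxPlaqs (lo i - 1) (hi i + 1) : Set (Plaq P (I i).k)) ⊆ plaqsInside (pts (I i).k (I i).Z))
    (hTG0 : ∀ i, T i = (box (fun κ => (hi i κ - lo i κ + 1).toNat) (lo i)).image fun x =>
      (⟨castSite (x - unitVec ⟨0, h0⟩), ⟨0, h0⟩⟩ : PBond P (I i).k))
    (hN5 : ∀ i κ, ((hi i κ - lo i κ + 1).toNat : ℤ) + 5 < P.sitesPerDir (I i).k)
    (K : ι → ℕ) (hK1 : ∀ i, 1 ≤ K i) (hKn : ∀ i κ, (hi i κ - lo i κ + 1).toNat ≤ K i)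
    (ext : ∀ i, GaugeField P (I i).k SU2 → GaugeField P (I i).k SU2)
    -- (ℓ2) REPLACED: the extension is r12's p. 193 shell-gauge extension, `Λ` non-degenerate, constant bookkeeping `hbxM`
    (hext : ∀ i Vk, ext i Vk = extend (pts (I i).k (I i).Λ) (shellGauge Vk (lo i) (hi i)) Vk)
    (hlohi : ∀ i, lo i ≤ hi i)
    {γ h₁ hst cJ bx : ℝ} (hγ : 0 < γ) (hh₁ : 0 ≤ h₁) (hhst : 0 ≤ hst) (hcJ : 0 ≤ cJ) (hbx : 0 ≤ bx)
    (hbxM : ∀ i, 12 * (P.d : ℝ) * ((n i : ℝ) + 2) ^ 2 ≤ bx * (I i).M ^ 2)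
    {ℓ ρ r eA eD a₁ δc Cerr eR : ι → ℝ} (hℓ : ∀ i, 0 ≤ ℓ i) (hr : ∀ i, 0 < r i) (heA : ∀ i, 0 < eA i) (heD : ∀ i, 0 < eD i)
    (heR : ∀ i, 0 < eR i) (hRg : ∀ i ε Vk, 0 < ε → ε ≤ eR i → (lfVarOn su2Chart I).Regular i ε Vk → Rg i Vk)
    (hδc : ∀ i, 0 < δc i) (ha₁ : ∀ i, 0 ≤ a₁ i) (hM : ∀ i, 1 ≤ (I i).M)
    -- (1.7) REPLACED: (1.67) [10] is consumed BY NAME (γ₀ = (4/π²)^{d+2}); what stays is the p. 357 identification of the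
    -- leading form with Σ_a ⟨B′_a, Δ_kB′_a⟩ of (1.65)–(1.66) [10] up to the two perturbation errors (`hlead`)
    (n' : ι → ℕ) (hn' : ∀ i, 1 ≤ n' i)
    (hlead : ∀ i Vk, Rg i Vk → ∀ X : GaugeSlice (pts (I i).k (I i).Λ) (T i) (EuclideanSpace ℝ (Fin 3)),
      |⟪H i Vk X, Δ₁ i Vk (H i Vk X)⟫ -
          ∑ a : Fin 3, formDk (n' i) (fun _ : Fin P.d => P.sitesPerDir (I i).k)
            (ofRealCfg (fun _ : Fin P.d => P.sitesPerDir (I i).k) fun j =>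
              ιA (pts (I i).k (I i).Λ) (T i) X ⟨j.1, j.2⟩ a)| ≤ Cerr i * ‖X‖ ^ 2)
    (hsm : ∀ i, Cerr i ≤ (4 / Real.pi ^ 2) ^ (P.d + 2) / (2 * (3 * (K i : ℝ) ^ 2 + 2 * (K i : ℝ) ^ 4)))
    (hγle : ∀ i, γ / (I i).M ^ 5 ≤ (4 / Real.pi ^ 2) ^ (P.d + 2) / (2 * (3 * (K i : ℝ) ^ 2 + 2 * (K i : ℝ) ^ 4)))
    (hH : ∀ i Vk, Rg i Vk → ∀ x, ‖H i Vk x‖ ≤ h₁ * ‖x‖) (hHst : ∀ i Vk, Rg i Vk → ∀ z, ‖Hst i Vk z‖ ≤ hst * ‖z‖)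
    (hdV0 : ∀ i Vk, Rg i Vk → dV i Vk 0 = 0)
    (hdV : ∀ i Vk, Rg i Vk → ∀ u v : F i, ‖u‖ ≤ ρ i → ‖v‖ ≤ ρ i → ‖dV i Vk u - dV i Vk v‖ ≤ ℓ i * ‖u - v‖)
    (hρ : ∀ i, h₁ * r i ≤ ρ i) (hsmall : ∀ i, (I i).M ^ 5 / γ * hst * ℓ i * h₁ ≤ 1 / 2)
    (hA : ∀ i Vk, Rg i Vk → ∀ X δ : GaugeSlice (pts (I i).k (I i).Λ) (T i) (EuclideanSpace ℝ (Fin 3)), ‖X‖ ≤ r i →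
      HasDerivAt (fun s : ℝ => (I i).f (expMul su2Chart (ιA (pts (I i).k (I i).Λ) (T i) (X + s • δ)) (ext i Vk)))
      (⟪δ, Hst i Vk (J i Vk)⟫ + ⟪δ, Hst i Vk (Δ₁ i Vk (H i Vk X))⟫ + ⟪δ, Hst i Vk (dV i Vk (H i Vk X))⟫) 0)
    (hJ : ∀ i ε Vk, 0 < ε → (lfVarOn su2Chart I).Regular i ε Vk → ‖J i Vk‖ ≤ cJ * ε)
    (hc3 : ∀ i Vk, Rg i Vk → ∀ B : GaugeSlice (pts (I i).k (I i).Λ) (T i) (EuclideanSpace ℝ (Fin 3)), ‖B‖ ≤ r i →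
      (IsCriticalPt su2Chart (bondsOf (pts (I i).k (I i).Λ)) (I i).f
          (expMul su2Chart (ιA (pts (I i).k (I i).Λ) (T i) B) (ext i Vk)) ↔
        ∀ δB : GaugeSlice (pts (I i).k (I i).Λ) (T i) (EuclideanSpace ℝ (Fin 3)),
          ⟪δB, Hst i Vk (J i Vk)⟫ + ⟪δB, Hst i Vk (Δ₁ i Vk (H i Vk B))⟫ + ⟪δB, Hst i Vk (dV i Vk (H i Vk B))⟫ = 0))
    (hc3'' : ∀ i (u : GaugeTransf P (I i).k SU2) (V : GaugeField P (I i).k SU2), IsGaugeOn (pts (I i).k (I i).Λ) u →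
      (I i).f (gaugeAct u V) = (I i).f V)
    (hAn : ∀ i ε Vk, 0 < ε → ε ≤ eA i → (lfVarOn su2Chart I).Regular i ε Vk → (I i).An ε Vk)
    (hdom : ∀ i, (I i).dom = domReg (I i).Z (I i).k (a₁ i))
    -- thresholds (`N i = √|free bonds|`)
    (hN' : ∀ i, Real.sqrt (freeBonds (pts (I i).k (I i).Λ) (T i)).card * (π / 2 * δc i) ≤ r i)
    (hδ : ∀ i ε, 0 < ε → ε ≤ eD i →
      ((n i : ℝ) + 2) * ((n i : ℝ) + P.d) * (a₁ i + (bx * (I i).M ^ 2 * ε + ε)) < δc i)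
    (he1 : ∀ i ε, 0 < ε → ε ≤ eD i → (4 * 1 * (2 * (I i).M ^ 5 * hst * cJ / γ) + bx * (I i).M ^ 2) * ε < a₁ i) :
    B15.Prop1Printed (lfVarOn su2Chart I) := by

  refine prop1Printed_lfVarOn_su2_box_G0_of_17_ext193_local hd3 h0 I Rg T H Hst hadj Δ₁ dV J lo hi n hn hN hbox hZ hTG0 hN5 K hK1
    hKn ext hext hlohi hγ (by positivity) hh₁ hhst hcJ hbx hbxM hℓ hr heA heD heR hRg hδc ha₁ hM ?_ hsm hγle hH hHst hdV0 hdV hρ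
    hsmall
    hA hJ hc3 hc3'' hAn hdom hN' hδ he1
  intro i Vk hR X
  have hm : ∀ κ, (((hi i κ - lo i κ + 1).toNat + 3 : ℕ) : ℤ) ≤ P.sitesPerDir (I i).k := fun κ => by
    have h5 := hN5 i κ
    push_cast
    linarith
  exact ineq17_of_lead (hlead i Vk hR X)
    (circ_le_sum_formDk h0 (hn' i) (fun κ => lo i κ - 2) hm (ιA (pts (I i).k (I i).Λ) (T i) X))


end Generic

/-! ## §2 Layers 6–10: print's instance, Proposition 4 [15], `H* := H†`, the domain constant, (c3) and `hF` derived (local) -/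

section Std

open Classical

variable {P : Params}

/-- **LOCAL twin of `B15Prop1StdInstanceSU2Box.prop1Printed_lfVarOn_std_su2_box`** (print's instance; `hRg` in print's regularity currency).
[cite: Balaban1989LargeFieldI, Prop. 1 (1.77)–(1.78) p.194; Balaban1989LargeFieldII, pp.357–359; Balaban1985Variational, (181) p.307] -/
theorem prop1Printed_lfVarOn_std_su2_box_local (hd3 : 3 ≤ P.d) (h0 : 0 < P.d) {ι : Type} {av : ∀ j, Averaging P j SU2}
    (bg : DetBackground P SU2 av) (M₁ : ℕ) (Z Λ : ι → Set (Site P 0)) (k : ι → ℕ) (M a₁ : ι → ℝ)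
    (An : ∀ i, ℝ → GaugeField P (k i) SU2 → Prop) (hk : ∀ i, k i ≤ P.m + P.K)
    (Rg : ∀ i, GaugeField P (k i) SU2 → Prop)
    -- (c3″) REPLACED by the [15] (181) covariance of the solution map at print's instance (`B15Prop1Carrier.std_f_gaugeAct`)
    (h181 : ∀ i (u : GaugeTransf P (k i) SU2), Cov181 bg (Bj M₁ (Z i) (k i)) (blockLift (k i) u))
    (T : ∀ i, Finset (PBond P (k i)))
    {F : ι → Type*} [∀ i, NormedAddCommGroup (F i)] [∀ i, InnerProductSpace ℝ (F i)]
    (H : ∀ i, GaugeField P (k i) SU2 →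
      (GaugeSlice (pts (k i) (Λ i)) (T i) (EuclideanSpace ℝ (Fin 3)) →ₗ[ℝ] F i))
    (Hst : ∀ i, GaugeField P (k i) SU2 →
      (F i →ₗ[ℝ] GaugeSlice (pts (k i) (Λ i)) (T i) (EuclideanSpace ℝ (Fin 3))))
    (hadj : ∀ i Vk (x : GaugeSlice (pts (k i) (Λ i)) (T i) (EuclideanSpace ℝ (Fin 3))) (y : F i),
      ⟪H i Vk x, y⟫ = ⟪x, Hst i Vk y⟫)
    (Δ₁ : ∀ i, GaugeField P (k i) SU2 → (F i →ₗ[ℝ] F i)) (dV : ∀ i, GaugeField P (k i) SU2 → F i → F i)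
    (J : ∀ i, GaugeField P (k i) SU2 → F i)
    (lo hi : ι → Fin P.d → ℤ) (n : ι → ℕ) (hn : ∀ i κ, hi i κ ≤ lo i κ + n i) (hN : ∀ i, n i + 2 < P.sitesPerDir (k i))
    (hbox : ∀ i, pts (k i) (Λ i) = (castSite '' Set.Icc (lo i) (hi i) : Set (Site P (k i))))
    (hZ : ∀ i, (boxPlaqs (lo i - 1) (hi i + 1) : Set (Plaq P (k i))) ⊆ plaqsInside (pts (k i) (Z i)))
    (hTG0 : ∀ i, T i = (box (fun κ => (hi i κ - lo i κ + 1).toNat) (lo i)).image fun x =>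
      (⟨castSite (x - unitVec ⟨0, h0⟩), ⟨0, h0⟩⟩ : PBond P (k i)))
    (hN5 : ∀ i κ, ((hi i κ - lo i κ + 1).toNat : ℤ) + 5 < P.sitesPerDir (k i))
    (K : ι → ℕ) (hK1 : ∀ i, 1 ≤ K i) (hKn : ∀ i κ, (hi i κ - lo i κ + 1).toNat ≤ K i)
    (ext : ∀ i, GaugeField P (k i) SU2 → GaugeField P (k i) SU2)
    -- (ℓ2) REPLACED: the extension is r12's p. 193 shell-gauge extension, `Λ` non-degenerate, constant bookkeeping `hbxM`
    (hext : ∀ i Vk, ext i Vk = extend (pts (k i) (Λ i)) (shellGauge Vk (lo i) (hi i)) Vk)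
    (hlohi : ∀ i, lo i ≤ hi i)
    {γ h₁ hst cJ bx : ℝ} (hγ : 0 < γ) (hh₁ : 0 ≤ h₁) (hhst : 0 ≤ hst) (hcJ : 0 ≤ cJ) (hbx : 0 ≤ bx)
    (hbxM : ∀ i, 12 * (P.d : ℝ) * ((n i : ℝ) + 2) ^ 2 ≤ bx * (M i) ^ 2)
    {ℓ ρ r eA eD δc Cerr eR : ι → ℝ} (hℓ : ∀ i, 0 ≤ ℓ i) (hr : ∀ i, 0 < r i) (heA : ∀ i, 0 < eA i) (heD : ∀ i, 0 < eD i)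
    (heR : ∀ i, 0 < eR i)
    (hRg : ∀ i ε Vk, 0 < ε → ε ≤ eR i → PlaqSmallOn (plaqsInside (pts (k i) (Z i ∩ (Λ i)ᶜ))) ε Vk → Rg i Vk)
    (hδc : ∀ i, 0 < δc i) (ha₁ : ∀ i, 0 ≤ a₁ i) (hM : ∀ i, 1 ≤ (M i))
    (n' : ι → ℕ) (hn' : ∀ i, 1 ≤ n' i)
    (hlead : ∀ i Vk, Rg i Vk → ∀ X : GaugeSlice (pts (k i) (Λ i)) (T i) (EuclideanSpace ℝ (Fin 3)),
      |⟪H i Vk X, Δ₁ i Vk (H i Vk X)⟫ -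
          ∑ a : Fin 3, formDk (n' i) (fun _ : Fin P.d => P.sitesPerDir (k i))
            (ofRealCfg (fun _ : Fin P.d => P.sitesPerDir (k i)) fun j =>
              ιA (pts (k i) (Λ i)) (T i) X ⟨j.1, j.2⟩ a)| ≤ Cerr i * ‖X‖ ^ 2)
    (hsm : ∀ i, Cerr i ≤ (4 / Real.pi ^ 2) ^ (P.d + 2) / (2 * (3 * (K i : ℝ) ^ 2 + 2 * (K i : ℝ) ^ 4)))
    (hγle : ∀ i, γ / (M i) ^ 5 ≤ (4 / Real.pi ^ 2) ^ (P.d + 2) / (2 * (3 * (K i : ℝ) ^ 2 + 2 * (K i : ℝ) ^ 4)))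
    (hH : ∀ i Vk, Rg i Vk → ∀ x, ‖H i Vk x‖ ≤ h₁ * ‖x‖) (hHst : ∀ i Vk, Rg i Vk → ∀ z, ‖Hst i Vk z‖ ≤ hst * ‖z‖)
    (hdV0 : ∀ i Vk, Rg i Vk → dV i Vk 0 = 0)
    (hdV : ∀ i Vk, Rg i Vk → ∀ u v : F i, ‖u‖ ≤ ρ i → ‖v‖ ≤ ρ i → ‖dV i Vk u - dV i Vk v‖ ≤ ℓ i * ‖u - v‖)
    (hρ : ∀ i, h₁ * r i ≤ ρ i) (hsmall : ∀ i, (M i) ^ 5 / γ * hst * ℓ i * h₁ ≤ 1 / 2)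
    (hA : ∀ i Vk, Rg i Vk → ∀ X δ : GaugeSlice (pts (k i) (Λ i)) (T i) (EuclideanSpace ℝ (Fin 3)), ‖X‖ ≤ r i →
      HasDerivAt (fun s : ℝ => (fun177std bg M₁ (Z i) (k i)) (expMul su2Chart (ιA (pts (k i) (Λ i)) (T i) (X + s • δ)) (ext i Vk)))
      (⟪δ, Hst i Vk (J i Vk)⟫ + ⟪δ, Hst i Vk (Δ₁ i Vk (H i Vk X))⟫ + ⟪δ, Hst i Vk (dV i Vk (H i Vk X))⟫) 0)
    (hJ : ∀ i ε Vk, 0 < ε → PlaqSmallOn (plaqsInside (pts (k i) (Z i ∩ (Λ i)ᶜ))) ε Vk → ‖J i Vk‖ ≤ cJ * ε)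
    (hc3 : ∀ i Vk, Rg i Vk → ∀ B : GaugeSlice (pts (k i) (Λ i)) (T i) (EuclideanSpace ℝ (Fin 3)), ‖B‖ ≤ r i →
      (IsCriticalPt su2Chart (bondsOf (pts (k i) (Λ i))) (fun177std bg M₁ (Z i) (k i))
          (expMul su2Chart (ιA (pts (k i) (Λ i)) (T i) B) (ext i Vk)) ↔
        ∀ δB : GaugeSlice (pts (k i) (Λ i)) (T i) (EuclideanSpace ℝ (Fin 3)),
          ⟪δB, Hst i Vk (J i Vk)⟫ + ⟪δB, Hst i Vk (Δ₁ i Vk (H i Vk B))⟫ + ⟪δB, Hst i Vk (dV i Vk (H i Vk B))⟫ = 0))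
    (hAn : ∀ i ε Vk, 0 < ε → ε ≤ eA i → PlaqSmallOn (plaqsInside (pts (k i) (Z i ∩ (Λ i)ᶜ))) ε Vk → An i ε Vk)
    -- thresholds (`N i = √|free bonds|`)
    (hN' : ∀ i, Real.sqrt (freeBonds (pts (k i) (Λ i)) (T i)).card * (π / 2 * δc i) ≤ r i)
    (hδ : ∀ i ε, 0 < ε → ε ≤ eD i →
      ((n i : ℝ) + 2) * ((n i : ℝ) + P.d) * (a₁ i + (bx * (M i) ^ 2 * ε + ε)) < δc i)
    (he1 : ∀ i ε, 0 < ε → ε ≤ eD i → (4 * 1 * (2 * (M i) ^ 5 * hst * cJ / γ) + bx * (M i) ^ 2) * ε < a₁ i) :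
    B15.Prop1Printed (lfVarOn su2Chart fun i => InstOn.std bg M₁ (Z i) (Λ i) (k i) (M i) (a₁ i) (An i)) := by

  refine prop1Printed_lfVarOn_su2_box_G0_of_167_local hd3 h0 (fun i => InstOn.std bg M₁ (Z i) (Λ i) (k i) (M i) (a₁ i) (An i))
    Rg T H Hst hadj Δ₁ dV J lo hi n hn hN hbox hZ hTG0 hN5 K hK1 hKn ext hext hlohi hγ hh₁ hhst hcJ hbx hbxM hℓ hr heA heD heR hRg
    hδc ha₁ hM n' hn' hlead hsm hγle hH hHst hdV0 hdV hρ hsmall hA hJ hc3 (fun i u V hu => ?_) hAn (fun i => rfl) hN' hδ he1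
  exact std_f_gaugeAct bg M₁ (hk i) (h181 i) (Λ i) (M i) (An i) u hu V

/-- **LOCAL twin of `B15Prop1LipschitzFromProp4.prop1Printed_lfVarOn_std_su2_box_of_prop4`** (`hW` asked at regular `V_k`).
[cite: Balaban1989LargeFieldI, Prop. 1 (1.77)–(1.78) p.194; Balaban1989LargeFieldII, pp.357–359; Balaban1985Variational, Prop. 4 pp.292–293, (181) p.307] -/
theorem prop1Printed_lfVarOn_std_su2_box_of_prop4_local (hd3 : 3 ≤ P.d) (h0 : 0 < P.d) {ι : Type} {av : ∀ j, Averaging P j SU2}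
    (bg : DetBackground P SU2 av) (M₁ : ℕ) (Z Λ : ι → Set (Site P 0)) (k : ι → ℕ) (M a₁ : ι → ℝ)
    (An : ∀ i, ℝ → GaugeField P (k i) SU2 → Prop) (hk : ∀ i, k i ≤ P.m + P.K)
    (Rg : ∀ i, GaugeField P (k i) SU2 → Prop)
    -- (c3″) REPLACED by the [15] (181) covariance of the solution map at print's instance (`B15Prop1Carrier.std_f_gaugeAct`)
    (h181 : ∀ i (u : GaugeTransf P (k i) SU2), Cov181 bg (Bj M₁ (Z i) (k i)) (blockLift (k i) u))
    (T : ∀ i, Finset (PBond P (k i)))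
    {F : ι → Type*} [∀ i, NormedAddCommGroup (F i)] [∀ i, InnerProductSpace ℝ (F i)]
    (H : ∀ i, GaugeField P (k i) SU2 →
      (GaugeSlice (pts (k i) (Λ i)) (T i) (EuclideanSpace ℝ (Fin 3)) →ₗ[ℝ] F i))
    (Hst : ∀ i, GaugeField P (k i) SU2 →
      (F i →ₗ[ℝ] GaugeSlice (pts (k i) (Λ i)) (T i) (EuclideanSpace ℝ (Fin 3))))
    (hadj : ∀ i Vk (x : GaugeSlice (pts (k i) (Λ i)) (T i) (EuclideanSpace ℝ (Fin 3))) (y : F i),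
      ⟪H i Vk x, y⟫ = ⟪x, Hst i Vk y⟫)
    (Δ₁ : ∀ i, GaugeField P (k i) SU2 → (F i →ₗ[ℝ] F i)) (dV : ∀ i, GaugeField P (k i) SU2 → F i → F i)
    -- (m3) REPLACED by Proposition 4 [15] in r08's typed form on the COMPLEXIFIED functional derivative `W = (δ/δA)V` on 𝔤ᶜ-valued
    -- fields (p. 359: «valid for 𝔤ᶜ-valued fields»), restricting to `dV` along an isometric embedding `emb` of the real fields
    {Fc : ι → Type*} [∀ i, NormedAddCommGroup (Fc i)] [∀ i, NormedSpace ℂ (Fc i)] (emb : ∀ i, F i → Fc i)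
    (hemb : ∀ i (u v : F i), ‖emb i u - emb i v‖ = ‖u - v‖) (hemb0 : ∀ i, emb i 0 = 0)
    (W : ∀ i, GaugeField P (k i) SU2 → Fc i → Fc i) {C₄ a₃ a : ι → ℝ} (hC₄ : ∀ i, 0 ≤ C₄ i) (ha : ∀ i, 0 < a i)
    (hW : ∀ i Vk, Rg i Vk → Prop4Hyp (W i Vk) (C₄ i) (a₃ i)) (hWdV : ∀ i Vk (u : F i), W i Vk (emb i u) = emb i (dV i Vk u))
    (J : ∀ i, GaugeField P (k i) SU2 → F i)
    (lo hi : ι → Fin P.d → ℤ) (n : ι → ℕ) (hn : ∀ i κ, hi i κ ≤ lo i κ + n i) (hN : ∀ i, n i + 2 < P.sitesPerDir (k i))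
    (hbox : ∀ i, pts (k i) (Λ i) = (castSite '' Set.Icc (lo i) (hi i) : Set (Site P (k i))))
    (hZ : ∀ i, (boxPlaqs (lo i - 1) (hi i + 1) : Set (Plaq P (k i))) ⊆ plaqsInside (pts (k i) (Z i)))
    (hTG0 : ∀ i, T i = (box (fun κ => (hi i κ - lo i κ + 1).toNat) (lo i)).image fun x =>
      (⟨castSite (x - unitVec ⟨0, h0⟩), ⟨0, h0⟩⟩ : PBond P (k i)))
    (hN5 : ∀ i κ, ((hi i κ - lo i κ + 1).toNat : ℤ) + 5 < P.sitesPerDir (k i))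
    (K : ι → ℕ) (hK1 : ∀ i, 1 ≤ K i) (hKn : ∀ i κ, (hi i κ - lo i κ + 1).toNat ≤ K i)
    (ext : ∀ i, GaugeField P (k i) SU2 → GaugeField P (k i) SU2)
    -- (ℓ2) REPLACED: the extension is r12's p. 193 shell-gauge extension, `Λ` non-degenerate, constant bookkeeping `hbxM`
    (hext : ∀ i Vk, ext i Vk = extend (pts (k i) (Λ i)) (shellGauge Vk (lo i) (hi i)) Vk)
    (hlohi : ∀ i, lo i ≤ hi i)
    {γ h₁ hst cJ bx : ℝ} (hγ : 0 < γ) (hh₁ : 0 ≤ h₁) (hhst : 0 ≤ hst) (hcJ : 0 ≤ cJ) (hbx : 0 ≤ bx)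
    (hbxM : ∀ i, 12 * (P.d : ℝ) * ((n i : ℝ) + 2) ^ 2 ≤ bx * (M i) ^ 2)
    {ρ r eA eD δc Cerr eR : ι → ℝ} (hr : ∀ i, 0 < r i) (heA : ∀ i, 0 < eA i) (heD : ∀ i, 0 < eD i)
    (heR : ∀ i, 0 < eR i)
    (hRg : ∀ i ε Vk, 0 < ε → ε ≤ eR i → PlaqSmallOn (plaqsInside (pts (k i) (Z i ∩ (Λ i)ᶜ))) ε Vk → Rg i Vk)
    (hδc : ∀ i, 0 < δc i) (ha₁ : ∀ i, 0 ≤ a₁ i) (hM : ∀ i, 1 ≤ (M i))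
    (n' : ι → ℕ) (hn' : ∀ i, 1 ≤ n' i)
    (hlead : ∀ i Vk, Rg i Vk → ∀ X : GaugeSlice (pts (k i) (Λ i)) (T i) (EuclideanSpace ℝ (Fin 3)),
      |⟪H i Vk X, Δ₁ i Vk (H i Vk X)⟫ -
          ∑ a : Fin 3, formDk (n' i) (fun _ : Fin P.d => P.sitesPerDir (k i))
            (ofRealCfg (fun _ : Fin P.d => P.sitesPerDir (k i)) fun j =>
              ιA (pts (k i) (Λ i)) (T i) X ⟨j.1, j.2⟩ a)| ≤ Cerr i * ‖X‖ ^ 2)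
    (hsm : ∀ i, Cerr i ≤ (4 / Real.pi ^ 2) ^ (P.d + 2) / (2 * (3 * (K i : ℝ) ^ 2 + 2 * (K i : ℝ) ^ 4)))
    (hγle : ∀ i, γ / (M i) ^ 5 ≤ (4 / Real.pi ^ 2) ^ (P.d + 2) / (2 * (3 * (K i : ℝ) ^ 2 + 2 * (K i : ℝ) ^ 4)))
    (hH : ∀ i Vk, Rg i Vk → ∀ x, ‖H i Vk x‖ ≤ h₁ * ‖x‖) (hHst : ∀ i Vk, Rg i Vk → ∀ z, ‖Hst i Vk z‖ ≤ hst * ‖z‖)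
    (hρ : ∀ i, h₁ * r i ≤ ρ i) (ha₃ : ∀ i, 2 * (ρ i + a i) ≤ a₃ i)
    (hsmall : ∀ i, (M i) ^ 5 / γ * hst * (4 * C₄ i * (ρ i + a i)) * h₁ ≤ 1 / 2)
    (hA : ∀ i Vk, Rg i Vk → ∀ X δ : GaugeSlice (pts (k i) (Λ i)) (T i) (EuclideanSpace ℝ (Fin 3)), ‖X‖ ≤ r i →
      HasDerivAt (fun s : ℝ => (fun177std bg M₁ (Z i) (k i)) (expMul su2Chart (ιA (pts (k i) (Λ i)) (T i) (X + s • δ)) (ext i Vk)))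
      (⟪δ, Hst i Vk (J i Vk)⟫ + ⟪δ, Hst i Vk (Δ₁ i Vk (H i Vk X))⟫ + ⟪δ, Hst i Vk (dV i Vk (H i Vk X))⟫) 0)
    (hJ : ∀ i ε Vk, 0 < ε → (lfVarOn su2Chart fun i => InstOn.std bg M₁ (Z i) (Λ i) (k i) (M i) (a₁ i) (An i)).Regular i ε Vk → ‖J i Vk‖ ≤ cJ * ε)
    (hc3 : ∀ i Vk, Rg i Vk → ∀ B : GaugeSlice (pts (k i) (Λ i)) (T i) (EuclideanSpace ℝ (Fin 3)), ‖B‖ ≤ r i →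
      (IsCriticalPt su2Chart (bondsOf (pts (k i) (Λ i))) (fun177std bg M₁ (Z i) (k i))
          (expMul su2Chart (ιA (pts (k i) (Λ i)) (T i) B) (ext i Vk)) ↔
        ∀ δB : GaugeSlice (pts (k i) (Λ i)) (T i) (EuclideanSpace ℝ (Fin 3)),
          ⟪δB, Hst i Vk (J i Vk)⟫ + ⟪δB, Hst i Vk (Δ₁ i Vk (H i Vk B))⟫ + ⟪δB, Hst i Vk (dV i Vk (H i Vk B))⟫ = 0))
    (hAn : ∀ i ε Vk, 0 < ε → ε ≤ eA i → (lfVarOn su2Chart fun i => InstOn.std bg M₁ (Z i) (Λ i) (k i) (M i) (a₁ i) (An i)).Regular i ε Vk → (An i) ε Vk)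
    -- thresholds (`N i = √|free bonds|`)
    (hN' : ∀ i, Real.sqrt (freeBonds (pts (k i) (Λ i)) (T i)).card * (π / 2 * δc i) ≤ r i)
    (hδ : ∀ i ε, 0 < ε → ε ≤ eD i →
      ((n i : ℝ) + 2) * ((n i : ℝ) + P.d) * (a₁ i + (bx * (M i) ^ 2 * ε + ε)) < δc i)
    (he1 : ∀ i ε, 0 < ε → ε ≤ eD i → (4 * 1 * (2 * (M i) ^ 5 * hst * cJ / γ) + bx * (M i) ^ 2) * ε < a₁ i) :
    B15.Prop1Printed (lfVarOn su2Chart fun i => InstOn.std bg M₁ (Z i) (Λ i) (k i) (M i) (a₁ i) (An i)) := by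

  have hρ0 : ∀ i, 0 ≤ ρ i := fun i => (mul_nonneg hh₁ (hr i).le).trans (hρ i)
  exact prop1Printed_lfVarOn_std_su2_box_local hd3 h0 bg M₁ Z Λ k M a₁ An hk Rg h181 T H Hst hadj Δ₁ dV J lo hi n hn hN hbox hZ
    hTG0 hN5 K hK1 hKn ext hext hlohi hγ hh₁ hhst hcJ hbx hbxM (fun i => by have := hC₄ i; have := ha i; have := hρ0 i; positivity)
    hr heA heD heR hRg hδc ha₁ hM n' hn' hlead hsm hγle hH hHst
    (fun i Vk hR => dV_zero_real_of_prop4Hyp (emb i) (hemb i) (hemb0 i) (hW i Vk hR) (by linarith [ha₃ i, ha i, hρ0 i]) (hWdV i Vk))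
    (fun i Vk hR => lipschitz_real_of_prop4Hyp (emb i) (hemb i) (hemb0 i) (hW i Vk hR) (hC₄ i) (ha i) (hρ0 i) (ha₃ i) (hWdV i Vk))
    hρ hsmall hA hJ hc3 hAn hN' hδ he1

/-- **LOCAL twin of `B15Prop1AdjointOfRecord.prop1Printed_lfVarOn_std_su2_box_adjoint`** (`H* := H†`).
[cite: Balaban1989LargeFieldI, Prop. 1 (1.77)–(1.78) p.194; Balaban1989LargeFieldII, (1.12)–(1.13) pp.358–359; Balaban1985Variational, Prop. 4 pp.292–293, (181) p.307, (190) p.308] -/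
theorem prop1Printed_lfVarOn_std_su2_box_adjoint_local (hd3 : 3 ≤ P.d) (h0 : 0 < P.d) {ι : Type} {av : ∀ j, Averaging P j SU2}
    (bg : DetBackground P SU2 av) (M₁ : ℕ) (Z Λ : ι → Set (Site P 0)) (k : ι → ℕ) (M a₁ : ι → ℝ)
    (An : ∀ i, ℝ → GaugeField P (k i) SU2 → Prop) (hk : ∀ i, k i ≤ P.m + P.K)
    (Rg : ∀ i, GaugeField P (k i) SU2 → Prop)
    -- (c3″) REPLACED by the [15] (181) covariance of the solution map at print's instance (`B15Prop1Carrier.std_f_gaugeAct`)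
    (h181 : ∀ i (u : GaugeTransf P (k i) SU2), Cov181 bg (Bj M₁ (Z i) (k i)) (blockLift (k i) u))
    (T : ∀ i, Finset (PBond P (k i)))
    -- (m2) adjoint half DISCHARGED: `H*_{1,k}` IS the adjoint of `H_{1,k}` ([IV] (1.78) context, [LF-II] p. 359), `F` finite-dimensional
    {F : ι → Type*} [∀ i, NormedAddCommGroup (F i)] [∀ i, InnerProductSpace ℝ (F i)] [∀ i, FiniteDimensional ℝ (F i)]
    (H : ∀ i, GaugeField P (k i) SU2 →
      (GaugeSlice (pts (k i) (Λ i)) (T i) (EuclideanSpace ℝ (Fin 3)) →ₗ[ℝ] F i))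
    (Δ₁ : ∀ i, GaugeField P (k i) SU2 → (F i →ₗ[ℝ] F i)) (dV : ∀ i, GaugeField P (k i) SU2 → F i → F i)
    -- (m3) REPLACED by Proposition 4 [15] in r08's typed form on the COMPLEXIFIED functional derivative `W = (δ/δA)V` on 𝔤ᶜ-valued
    -- fields (p. 359: «valid for 𝔤ᶜ-valued fields»), restricting to `dV` along an isometric embedding `emb` of the real fields
    {Fc : ι → Type*} [∀ i, NormedAddCommGroup (Fc i)] [∀ i, NormedSpace ℂ (Fc i)] (emb : ∀ i, F i → Fc i)
    (hemb : ∀ i (u v : F i), ‖emb i u - emb i v‖ = ‖u - v‖) (hemb0 : ∀ i, emb i 0 = 0)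
    (W : ∀ i, GaugeField P (k i) SU2 → Fc i → Fc i) {C₄ a₃ a : ι → ℝ} (hC₄ : ∀ i, 0 ≤ C₄ i) (ha : ∀ i, 0 < a i)
    (hW : ∀ i Vk, Rg i Vk → Prop4Hyp (W i Vk) (C₄ i) (a₃ i)) (hWdV : ∀ i Vk (u : F i), W i Vk (emb i u) = emb i (dV i Vk u))
    (J : ∀ i, GaugeField P (k i) SU2 → F i)
    (lo hi : ι → Fin P.d → ℤ) (n : ι → ℕ) (hn : ∀ i κ, hi i κ ≤ lo i κ + n i) (hN : ∀ i, n i + 2 < P.sitesPerDir (k i))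
    (hbox : ∀ i, pts (k i) (Λ i) = (castSite '' Set.Icc (lo i) (hi i) : Set (Site P (k i))))
    (hZ : ∀ i, (boxPlaqs (lo i - 1) (hi i + 1) : Set (Plaq P (k i))) ⊆ plaqsInside (pts (k i) (Z i)))
    (hTG0 : ∀ i, T i = (box (fun κ => (hi i κ - lo i κ + 1).toNat) (lo i)).image fun x =>
      (⟨castSite (x - unitVec ⟨0, h0⟩), ⟨0, h0⟩⟩ : PBond P (k i)))
    (hN5 : ∀ i κ, ((hi i κ - lo i κ + 1).toNat : ℤ) + 5 < P.sitesPerDir (k i))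
    (K : ι → ℕ) (hK1 : ∀ i, 1 ≤ K i) (hKn : ∀ i κ, (hi i κ - lo i κ + 1).toNat ≤ K i)
    (ext : ∀ i, GaugeField P (k i) SU2 → GaugeField P (k i) SU2)
    -- (ℓ2) REPLACED: the extension is r12's p. 193 shell-gauge extension, `Λ` non-degenerate, constant bookkeeping `hbxM`
    (hext : ∀ i Vk, ext i Vk = extend (pts (k i) (Λ i)) (shellGauge Vk (lo i) (hi i)) Vk)
    (hlohi : ∀ i, lo i ≤ hi i)
    {γ h₁ cJ bx : ℝ} (hγ : 0 < γ) (hh₁ : 0 ≤ h₁) (hcJ : 0 ≤ cJ) (hbx : 0 ≤ bx)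
    (hbxM : ∀ i, 12 * (P.d : ℝ) * ((n i : ℝ) + 2) ^ 2 ≤ bx * (M i) ^ 2)
    {ρ r eA eD δc Cerr eR : ι → ℝ} (hr : ∀ i, 0 < r i) (heA : ∀ i, 0 < eA i) (heD : ∀ i, 0 < eD i)
    (heR : ∀ i, 0 < eR i)
    (hRg : ∀ i ε Vk, 0 < ε → ε ≤ eR i → PlaqSmallOn (plaqsInside (pts (k i) (Z i ∩ (Λ i)ᶜ))) ε Vk → Rg i Vk)
    (hδc : ∀ i, 0 < δc i) (ha₁ : ∀ i, 0 ≤ a₁ i) (hM : ∀ i, 1 ≤ (M i))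
    (n' : ι → ℕ) (hn' : ∀ i, 1 ≤ n' i)
    (hlead : ∀ i Vk, Rg i Vk → ∀ X : GaugeSlice (pts (k i) (Λ i)) (T i) (EuclideanSpace ℝ (Fin 3)),
      |⟪H i Vk X, Δ₁ i Vk (H i Vk X)⟫ -
          ∑ a : Fin 3, formDk (n' i) (fun _ : Fin P.d => P.sitesPerDir (k i))
            (ofRealCfg (fun _ : Fin P.d => P.sitesPerDir (k i)) fun j =>
              ιA (pts (k i) (Λ i)) (T i) X ⟨j.1, j.2⟩ a)| ≤ Cerr i * ‖X‖ ^ 2)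
    (hsm : ∀ i, Cerr i ≤ (4 / Real.pi ^ 2) ^ (P.d + 2) / (2 * (3 * (K i : ℝ) ^ 2 + 2 * (K i : ℝ) ^ 4)))
    (hγle : ∀ i, γ / (M i) ^ 5 ≤ (4 / Real.pi ^ 2) ^ (P.d + 2) / (2 * (3 * (K i : ℝ) ^ 2 + 2 * (K i : ℝ) ^ 4)))
    (hH : ∀ i Vk, Rg i Vk → ∀ x, ‖H i Vk x‖ ≤ h₁ * ‖x‖)
    (hρ : ∀ i, h₁ * r i ≤ ρ i) (ha₃ : ∀ i, 2 * (ρ i + a i) ≤ a₃ i)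
    (hsmall : ∀ i, (M i) ^ 5 / γ * h₁ * (4 * C₄ i * (ρ i + a i)) * h₁ ≤ 1 / 2)
    (hA : ∀ i Vk, Rg i Vk → ∀ X δ : GaugeSlice (pts (k i) (Λ i)) (T i) (EuclideanSpace ℝ (Fin 3)), ‖X‖ ≤ r i →
      HasDerivAt (fun s : ℝ => (fun177std bg M₁ (Z i) (k i)) (expMul su2Chart (ιA (pts (k i) (Λ i)) (T i) (X + s • δ)) (ext i Vk)))
      (⟪H i Vk δ, J i Vk⟫ + ⟪H i Vk δ, Δ₁ i Vk (H i Vk X)⟫ + ⟪H i Vk δ, dV i Vk (H i Vk X)⟫) 0)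
    (hJ : ∀ i ε Vk, 0 < ε → PlaqSmallOn (plaqsInside (pts (k i) (Z i ∩ (Λ i)ᶜ))) ε Vk → ‖J i Vk‖ ≤ cJ * ε)
    (hc3 : ∀ i Vk, Rg i Vk → ∀ B : GaugeSlice (pts (k i) (Λ i)) (T i) (EuclideanSpace ℝ (Fin 3)), ‖B‖ ≤ r i →
      (IsCriticalPt su2Chart (bondsOf (pts (k i) (Λ i))) (fun177std bg M₁ (Z i) (k i))
          (expMul su2Chart (ιA (pts (k i) (Λ i)) (T i) B) (ext i Vk)) ↔
        ∀ δB : GaugeSlice (pts (k i) (Λ i)) (T i) (EuclideanSpace ℝ (Fin 3)),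
          ⟪H i Vk δB, J i Vk⟫ + ⟪H i Vk δB, Δ₁ i Vk (H i Vk B)⟫ + ⟪H i Vk δB, dV i Vk (H i Vk B)⟫ = 0))
    (hAn : ∀ i ε Vk, 0 < ε → ε ≤ eA i → PlaqSmallOn (plaqsInside (pts (k i) (Z i ∩ (Λ i)ᶜ))) ε Vk → An i ε Vk)
    -- thresholds (`N i = √|free bonds|`)
    (hN' : ∀ i, Real.sqrt (freeBonds (pts (k i) (Λ i)) (T i)).card * (π / 2 * δc i) ≤ r i)
    (hδ : ∀ i ε, 0 < ε → ε ≤ eD i →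
      ((n i : ℝ) + 2) * ((n i : ℝ) + P.d) * (a₁ i + (bx * (M i) ^ 2 * ε + ε)) < δc i)
    (he1 : ∀ i ε, 0 < ε → ε ≤ eD i → (4 * 1 * (2 * (M i) ^ 5 * h₁ * cJ / γ) + bx * (M i) ^ 2) * ε < a₁ i) :
    B15.Prop1Printed (lfVarOn su2Chart fun i => InstOn.std bg M₁ (Z i) (Λ i) (k i) (M i) (a₁ i) (An i)) := by
  refine prop1Printed_lfVarOn_std_su2_box_of_prop4_local hd3 h0 bg M₁ Z Λ k M a₁ An hk Rg h181 T H
    (fun i Vk => LinearMap.adjoint (H i Vk)) (fun i Vk x y => (LinearMap.adjoint_inner_right (H i Vk) x y).symm) Δ₁ dV emb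
    hemb hemb0 W hC₄ ha hW hWdV J lo hi n hn hN hbox hZ hTG0 hN5 K hK1 hKn ext hext hlohi hγ hh₁ hh₁ hcJ hbx hbxM hr heA heD
    heR hRg hδc ha₁ hM n' hn' hlead hsm hγle hH (fun i Vk hR z => norm_adjoint_apply_le (H i Vk) hh₁ (hH i Vk hR) z) hρ ha₃
    hsmall (fun i Vk hR X δ hX => ?_) hJ (fun i Vk hR B hB => ?_) hAn hN' hδ he1
  · simpa only [LinearMap.adjoint_inner_right] using hA i Vk hR X δ hX
  · simpa only [LinearMap.adjoint_inner_right] using hc3 i Vk hR B hB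

/-- **LOCAL twin of `B15Prop1AdjointOfRecord.exists_domain_prop1Printed_lfVarOn_std_su2_box`** (the domain constant chosen).
[cite: Balaban1989LargeFieldI, Prop. 1 (1.77)–(1.78) p.194, p.193; Balaban1989LargeFieldII, pp.357–359] -/
theorem exists_domain_prop1Printed_lfVarOn_std_su2_box_local (hd3 : 3 ≤ P.d) (h0 : 0 < P.d) {ι : Type} {av : ∀ j, Averaging P j SU2}
    (bg : DetBackground P SU2 av) (M₁ : ℕ) (Z Λ : ι → Set (Site P 0)) (k : ι → ℕ) (M : ι → ℝ)
    (An : ∀ i, ℝ → GaugeField P (k i) SU2 → Prop) (hk : ∀ i, k i ≤ P.m + P.K)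
    (Rg : ∀ i, GaugeField P (k i) SU2 → Prop)
    -- (c3″) REPLACED by the [15] (181) covariance of the solution map at print's instance (`B15Prop1Carrier.std_f_gaugeAct`)
    (h181 : ∀ i (u : GaugeTransf P (k i) SU2), Cov181 bg (Bj M₁ (Z i) (k i)) (blockLift (k i) u))
    (T : ∀ i, Finset (PBond P (k i)))
    -- (m2) adjoint half DISCHARGED: `H*_{1,k}` IS the adjoint of `H_{1,k}` ([IV] (1.78) context, [LF-II] p. 359), `F` finite-dimensional
    {F : ι → Type*} [∀ i, NormedAddCommGroup (F i)] [∀ i, InnerProductSpace ℝ (F i)] [∀ i, FiniteDimensional ℝ (F i)]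
    (H : ∀ i, GaugeField P (k i) SU2 →
      (GaugeSlice (pts (k i) (Λ i)) (T i) (EuclideanSpace ℝ (Fin 3)) →ₗ[ℝ] F i))
    (Δ₁ : ∀ i, GaugeField P (k i) SU2 → (F i →ₗ[ℝ] F i)) (dV : ∀ i, GaugeField P (k i) SU2 → F i → F i)
    -- (m3) REPLACED by Proposition 4 [15] in r08's typed form on the COMPLEXIFIED functional derivative `W = (δ/δA)V` on 𝔤ᶜ-valued
    -- fields (p. 359: «valid for 𝔤ᶜ-valued fields»), restricting to `dV` along an isometric embedding `emb` of the real fields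
    {Fc : ι → Type*} [∀ i, NormedAddCommGroup (Fc i)] [∀ i, NormedSpace ℂ (Fc i)] (emb : ∀ i, F i → Fc i)
    (hemb : ∀ i (u v : F i), ‖emb i u - emb i v‖ = ‖u - v‖) (hemb0 : ∀ i, emb i 0 = 0)
    (W : ∀ i, GaugeField P (k i) SU2 → Fc i → Fc i) {C₄ a₃ a : ι → ℝ} (hC₄ : ∀ i, 0 ≤ C₄ i) (ha : ∀ i, 0 < a i)
    (hW : ∀ i Vk, Rg i Vk → Prop4Hyp (W i Vk) (C₄ i) (a₃ i)) (hWdV : ∀ i Vk (u : F i), W i Vk (emb i u) = emb i (dV i Vk u))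
    (J : ∀ i, GaugeField P (k i) SU2 → F i)
    (lo hi : ι → Fin P.d → ℤ) (n : ι → ℕ) (hn : ∀ i κ, hi i κ ≤ lo i κ + n i) (hN : ∀ i, n i + 2 < P.sitesPerDir (k i))
    (hbox : ∀ i, pts (k i) (Λ i) = (castSite '' Set.Icc (lo i) (hi i) : Set (Site P (k i))))
    (hZ : ∀ i, (boxPlaqs (lo i - 1) (hi i + 1) : Set (Plaq P (k i))) ⊆ plaqsInside (pts (k i) (Z i)))
    (hTG0 : ∀ i, T i = (box (fun κ => (hi i κ - lo i κ + 1).toNat) (lo i)).image fun x =>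
      (⟨castSite (x - unitVec ⟨0, h0⟩), ⟨0, h0⟩⟩ : PBond P (k i)))
    (hN5 : ∀ i κ, ((hi i κ - lo i κ + 1).toNat : ℤ) + 5 < P.sitesPerDir (k i))
    (K : ι → ℕ) (hK1 : ∀ i, 1 ≤ K i) (hKn : ∀ i κ, (hi i κ - lo i κ + 1).toNat ≤ K i)
    (ext : ∀ i, GaugeField P (k i) SU2 → GaugeField P (k i) SU2)
    -- (ℓ2) REPLACED: the extension is r12's p. 193 shell-gauge extension, `Λ` non-degenerate, constant bookkeeping `hbxM`
    (hext : ∀ i Vk, ext i Vk = extend (pts (k i) (Λ i)) (shellGauge Vk (lo i) (hi i)) Vk)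
    (hlohi : ∀ i, lo i ≤ hi i)
    {γ h₁ cJ bx : ℝ} (hγ : 0 < γ) (hh₁ : 0 ≤ h₁) (hcJ : 0 ≤ cJ) (hbx : 0 ≤ bx)
    (hbxM : ∀ i, 12 * (P.d : ℝ) * ((n i : ℝ) + 2) ^ 2 ≤ bx * (M i) ^ 2)
    {ρ r eA Cerr eR : ι → ℝ} (hr : ∀ i, 0 < r i) (heA : ∀ i, 0 < eA i) (hM : ∀ i, 1 ≤ (M i))
    (heR : ∀ i, 0 < eR i)
    (hRg : ∀ i ε Vk, 0 < ε → ε ≤ eR i → PlaqSmallOn (plaqsInside (pts (k i) (Z i ∩ (Λ i)ᶜ))) ε Vk → Rg i Vk)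
    (n' : ι → ℕ) (hn' : ∀ i, 1 ≤ n' i)
    (hlead : ∀ i Vk, Rg i Vk → ∀ X : GaugeSlice (pts (k i) (Λ i)) (T i) (EuclideanSpace ℝ (Fin 3)),
      |⟪H i Vk X, Δ₁ i Vk (H i Vk X)⟫ -
          ∑ a : Fin 3, formDk (n' i) (fun _ : Fin P.d => P.sitesPerDir (k i))
            (ofRealCfg (fun _ : Fin P.d => P.sitesPerDir (k i)) fun j =>
              ιA (pts (k i) (Λ i)) (T i) X ⟨j.1, j.2⟩ a)| ≤ Cerr i * ‖X‖ ^ 2)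
    (hsm : ∀ i, Cerr i ≤ (4 / Real.pi ^ 2) ^ (P.d + 2) / (2 * (3 * (K i : ℝ) ^ 2 + 2 * (K i : ℝ) ^ 4)))
    (hγle : ∀ i, γ / (M i) ^ 5 ≤ (4 / Real.pi ^ 2) ^ (P.d + 2) / (2 * (3 * (K i : ℝ) ^ 2 + 2 * (K i : ℝ) ^ 4)))
    (hH : ∀ i Vk, Rg i Vk → ∀ x, ‖H i Vk x‖ ≤ h₁ * ‖x‖)
    (hρ : ∀ i, h₁ * r i ≤ ρ i) (ha₃ : ∀ i, 2 * (ρ i + a i) ≤ a₃ i)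
    (hsmall : ∀ i, (M i) ^ 5 / γ * h₁ * (4 * C₄ i * (ρ i + a i)) * h₁ ≤ 1 / 2)
    (hA : ∀ i Vk, Rg i Vk → ∀ X δ : GaugeSlice (pts (k i) (Λ i)) (T i) (EuclideanSpace ℝ (Fin 3)), ‖X‖ ≤ r i →
      HasDerivAt (fun s : ℝ => (fun177std bg M₁ (Z i) (k i)) (expMul su2Chart (ιA (pts (k i) (Λ i)) (T i) (X + s • δ)) (ext i Vk)))
      (⟪H i Vk δ, J i Vk⟫ + ⟪H i Vk δ, Δ₁ i Vk (H i Vk X)⟫ + ⟪H i Vk δ, dV i Vk (H i Vk X)⟫) 0)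
    (hJ : ∀ i ε Vk, 0 < ε → PlaqSmallOn (plaqsInside (pts (k i) (Z i ∩ (Λ i)ᶜ))) ε Vk → ‖J i Vk‖ ≤ cJ * ε)
    (hc3 : ∀ i Vk, Rg i Vk → ∀ B : GaugeSlice (pts (k i) (Λ i)) (T i) (EuclideanSpace ℝ (Fin 3)), ‖B‖ ≤ r i →
      (IsCriticalPt su2Chart (bondsOf (pts (k i) (Λ i))) (fun177std bg M₁ (Z i) (k i))
          (expMul su2Chart (ιA (pts (k i) (Λ i)) (T i) B) (ext i Vk)) ↔
        ∀ δB : GaugeSlice (pts (k i) (Λ i)) (T i) (EuclideanSpace ℝ (Fin 3)),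
          ⟪H i Vk δB, J i Vk⟫ + ⟪H i Vk δB, Δ₁ i Vk (H i Vk B)⟫ + ⟪H i Vk δB, dV i Vk (H i Vk B)⟫ = 0))
    (hAn : ∀ i ε Vk, 0 < ε → ε ≤ eA i → PlaqSmallOn (plaqsInside (pts (k i) (Z i ∩ (Λ i)ᶜ))) ε Vk → An i ε Vk)
    : ∃ a₁ : ι → ℝ, (∀ i, 0 < a₁ i) ∧
      B15.Prop1Printed (lfVarOn su2Chart fun i => InstOn.std bg M₁ (Z i) (Λ i) (k i) (M i) (a₁ i) (An i)) := by
  classical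
  have hex : ∀ i, ∃ δc a₁ eD : ℝ, 0 < δc ∧ 0 < a₁ ∧ 0 < eD ∧
      Real.sqrt (freeBonds (pts (k i) (Λ i)) (T i)).card * (π / 2 * δc) ≤ r i ∧
      (∀ ε : ℝ, 0 < ε → ε ≤ eD → ((n i : ℝ) + 2) * ((n i : ℝ) + P.d) * (a₁ + (bx * (M i) ^ 2 * ε + ε)) < δc) ∧
      ∀ ε : ℝ, 0 < ε → ε ≤ eD → (4 * 1 * (2 * (M i) ^ 5 * h₁ * cJ / γ) + bx * (M i) ^ 2) * ε < a₁ :=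
    fun i => thresholds_exist _ (hr i) hγ (hM i) hh₁ hcJ hbx (n i) P.d
  choose δc a₁ eD hδc ha₁ heD hN' hδ he1 using hex
  exact ⟨a₁, ha₁, prop1Printed_lfVarOn_std_su2_box_adjoint_local hd3 h0 bg M₁ Z Λ k M a₁ An hk Rg h181 T H Δ₁ dV emb hemb hemb0 W
    hC₄ ha hW hWdV J lo hi n hn hN hbox hZ hTG0 hN5 K hK1 hKn ext hext hlohi hγ hh₁ hcJ hbx hbxM hr heA heD heR hRg hδc
    (fun i => (ha₁ i).le) hM n' hn' hlead hsm hγle hH hρ ha₃ hsmall hA hJ hc3 hAn hN' hδ he1⟩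

/-- **LOCAL twin of `B15Prop1CriticalAtBoxG0.exists_domain_prop1Printed_lfVarOn_std_su2_box_of_fderiv`** ((c3) derived; `hF` at regular `V_k` on
the ball). [cite: Balaban1989LargeFieldI, Prop. 1 (1.77)–(1.78) p.194, p.193; Balaban1989LargeFieldII, pp.357–359, (1.12); Balaban1985Variational,
Prop. 4 pp.292–293, (181) p.307, (190) p.308] -/
theorem exists_domain_prop1Printed_lfVarOn_std_su2_box_of_fderiv_local (hd3 : 3 ≤ P.d) (h0 : 0 < P.d) {ι : Type}
    {av : ∀ j, Averaging P j SU2}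
    (bg : DetBackground P SU2 av) (M₁ : ℕ) (Z Λ : ι → Set (Site P 0)) (k : ι → ℕ) (M : ι → ℝ)
    (An : ∀ i, ℝ → GaugeField P (k i) SU2 → Prop) (hk : ∀ i, k i ≤ P.m + P.K)
    (Rg : ∀ i, GaugeField P (k i) SU2 → Prop)
    (h181 : ∀ i (u : GaugeTransf P (k i) SU2), Cov181 bg (Bj M₁ (Z i) (k i)) (blockLift (k i) u))
    (T : ∀ i, Finset (PBond P (k i)))
    {F : ι → Type*} [∀ i, NormedAddCommGroup (F i)] [∀ i, InnerProductSpace ℝ (F i)] [∀ i, FiniteDimensional ℝ (F i)]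
    (H : ∀ i, GaugeField P (k i) SU2 →
      (GaugeSlice (pts (k i) (Λ i)) (T i) (EuclideanSpace ℝ (Fin 3)) →ₗ[ℝ] F i))
    (Δ₁ : ∀ i, GaugeField P (k i) SU2 → (F i →ₗ[ℝ] F i)) (dV : ∀ i, GaugeField P (k i) SU2 → F i → F i)
    {Fc : ι → Type*} [∀ i, NormedAddCommGroup (Fc i)] [∀ i, NormedSpace ℂ (Fc i)] (emb : ∀ i, F i → Fc i)
    (hemb : ∀ i (u v : F i), ‖emb i u - emb i v‖ = ‖u - v‖) (hemb0 : ∀ i, emb i 0 = 0)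
    (W : ∀ i, GaugeField P (k i) SU2 → Fc i → Fc i) {C₄ a₃ a : ι → ℝ} (hC₄ : ∀ i, 0 ≤ C₄ i) (ha : ∀ i, 0 < a i)
    (hW : ∀ i Vk, Rg i Vk → Prop4Hyp (W i Vk) (C₄ i) (a₃ i)) (hWdV : ∀ i Vk (u : F i), W i Vk (emb i u) = emb i (dV i Vk u))
    (J : ∀ i, GaugeField P (k i) SU2 → F i)
    (lo hi : ι → Fin P.d → ℤ) (n : ι → ℕ) (hn : ∀ i κ, hi i κ ≤ lo i κ + n i) (hN : ∀ i, n i + 2 < P.sitesPerDir (k i))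
    (hbox : ∀ i, pts (k i) (Λ i) = (castSite '' Set.Icc (lo i) (hi i) : Set (Site P (k i))))
    (hZ : ∀ i, (boxPlaqs (lo i - 1) (hi i + 1) : Set (Plaq P (k i))) ⊆ plaqsInside (pts (k i) (Z i)))
    (hTG0 : ∀ i, T i = (box (fun κ => (hi i κ - lo i κ + 1).toNat) (lo i)).image fun x =>
      (⟨castSite (x - unitVec ⟨0, h0⟩), ⟨0, h0⟩⟩ : PBond P (k i)))
    (hN5 : ∀ i κ, ((hi i κ - lo i κ + 1).toNat : ℤ) + 5 < P.sitesPerDir (k i))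
    (K : ι → ℕ) (hK1 : ∀ i, 1 ≤ K i) (hKn : ∀ i κ, (hi i κ - lo i κ + 1).toNat ≤ K i)
    (ext : ∀ i, GaugeField P (k i) SU2 → GaugeField P (k i) SU2)
    (hext : ∀ i Vk, ext i Vk = extend (pts (k i) (Λ i)) (shellGauge Vk (lo i) (hi i)) Vk)
    (hlohi : ∀ i, lo i ≤ hi i)
    {γ h₁ cJ bx : ℝ} (hγ : 0 < γ) (hh₁ : 0 ≤ h₁) (hcJ : 0 ≤ cJ) (hbx : 0 ≤ bx)
    (hbxM : ∀ i, 12 * (P.d : ℝ) * ((n i : ℝ) + 2) ^ 2 ≤ bx * (M i) ^ 2)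
    {ρ r eA Cerr eR : ι → ℝ} (hr : ∀ i, 0 < r i) (heA : ∀ i, 0 < eA i) (hM : ∀ i, 1 ≤ (M i))
    (heR : ∀ i, 0 < eR i)
    (hRg : ∀ i ε Vk, 0 < ε → ε ≤ eR i → PlaqSmallOn (plaqsInside (pts (k i) (Z i ∩ (Λ i)ᶜ))) ε Vk → Rg i Vk)
    (n' : ι → ℕ) (hn' : ∀ i, 1 ≤ n' i)
    (hlead : ∀ i Vk, Rg i Vk → ∀ X : GaugeSlice (pts (k i) (Λ i)) (T i) (EuclideanSpace ℝ (Fin 3)),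
      |⟪H i Vk X, Δ₁ i Vk (H i Vk X)⟫ -
          ∑ a : Fin 3, formDk (n' i) (fun _ : Fin P.d => P.sitesPerDir (k i))
            (ofRealCfg (fun _ : Fin P.d => P.sitesPerDir (k i)) fun j =>
              ιA (pts (k i) (Λ i)) (T i) X ⟨j.1, j.2⟩ a)| ≤ Cerr i * ‖X‖ ^ 2)
    (hsm : ∀ i, Cerr i ≤ (4 / Real.pi ^ 2) ^ (P.d + 2) / (2 * (3 * (K i : ℝ) ^ 2 + 2 * (K i : ℝ) ^ 4)))
    (hγle : ∀ i, γ / (M i) ^ 5 ≤ (4 / Real.pi ^ 2) ^ (P.d + 2) / (2 * (3 * (K i : ℝ) ^ 2 + 2 * (K i : ℝ) ^ 4)))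
    (hH : ∀ i Vk, Rg i Vk → ∀ x, ‖H i Vk x‖ ≤ h₁ * ‖x‖)
    (hρ : ∀ i, h₁ * r i ≤ ρ i) (ha₃ : ∀ i, 2 * (ρ i + a i) ≤ a₃ i)
    (hsmall : ∀ i, (M i) ^ 5 / γ * h₁ * (4 * C₄ i * (ρ i + a i)) * h₁ ≤ 1 / 2)
    (hA : ∀ i Vk, Rg i Vk → ∀ X δ : GaugeSlice (pts (k i) (Λ i)) (T i) (EuclideanSpace ℝ (Fin 3)), ‖X‖ ≤ r i →
      HasDerivAt (fun s : ℝ => (fun177std bg M₁ (Z i) (k i)) (expMul su2Chart (ιA (pts (k i) (Λ i)) (T i) (X + s • δ)) (ext i Vk)))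
      (⟪H i Vk δ, J i Vk⟫ + ⟪H i Vk δ, Δ₁ i Vk (H i Vk X)⟫ + ⟪H i Vk δ, dV i Vk (H i Vk X)⟫) 0)
    (hJ : ∀ i ε Vk, 0 < ε → PlaqSmallOn (plaqsInside (pts (k i) (Z i ∩ (Λ i)ᶜ))) ε Vk → ‖J i Vk‖ ≤ cJ * ε)
    -- (c3) REPLACED by: differentiability through the chart at the chart points of the ball, and `r ≤ 1/2`
    (hF : ∀ i Vk, Rg i Vk → ∀ B : GaugeSlice (pts (k i) (Λ i)) (T i) (EuclideanSpace ℝ (Fin 3)), ‖B‖ ≤ r i →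
      ∃ D : VecField P (k i) (EuclideanSpace ℝ (Fin 3)) →L[ℝ] ℝ,
        HasFDerivAt (fun A => (fun177std bg M₁ (Z i) (k i))
          (expMul su2Chart A (expMul su2Chart (ιA (pts (k i) (Λ i)) (T i) B) (ext i Vk)))) D 0)
    (hr2 : ∀ i, r i ≤ 1 / 2)
    (hAn : ∀ i ε Vk, 0 < ε → ε ≤ eA i → PlaqSmallOn (plaqsInside (pts (k i) (Z i ∩ (Λ i)ᶜ))) ε Vk → An i ε Vk)
    : ∃ a₁ : ι → ℝ, (∀ i, 0 < a₁ i) ∧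
      B15.Prop1Printed (lfVarOn su2Chart fun i => InstOn.std bg M₁ (Z i) (Λ i) (k i) (M i) (a₁ i) (An i)) := by
  refine exists_domain_prop1Printed_lfVarOn_std_su2_box_local hd3 h0 bg M₁ Z Λ k M An hk Rg h181 T H Δ₁ dV emb hemb hemb0 W hC₄
    ha hW hWdV J lo hi n hn hN hbox hZ hTG0 hN5 K hK1 hKn ext hext hlohi hγ hh₁ hcJ hbx hbxM hr heA hM heR hRg n' hn' hlead hsm hγle
    hH hρ ha₃ hsmall hA hJ (fun i Vk hR B hB => ?_) hAn
  -- (c3) at the chart point `exp(i·ιA B)·Ṽ_k`, `‖B‖ ≤ r i ≤ 1/2`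
  have hNw : ∀ κ, hi i κ - lo i κ + 1 < (P.sitesPerDir (k i) : ℤ) := fun κ => by
    have h5 := hN5 i κ
    have : hi i κ - lo i κ + 1 ≤ ((hi i κ - lo i κ + 1).toNat : ℤ) := Int.self_le_toNat _
    linarith
  have hT : TreeOrder (T i) PBond.tgt (boxDepth (lo i - e ⟨0, h0⟩) (hi i)) := by
    rw [hTG0 i]; exact treeOrder_G0 h0 hNw
  have hv : ∀ b ∈ T i, b.tgt ∈ pts (k i) (Λ i) := fun b hb => by
    rw [hbox i]; rw [hTG0 i] at hb; exact tgt_G0_mem h0 (lo i) (hi i) b hb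
  have hf : ∀ u : GaugeTransf P (k i) SU2, IsGaugeOn (pts (k i) (Λ i)) u →
      ∀ V, fun177std bg M₁ (Z i) (k i) (gaugeAct u V) = fun177std bg M₁ (Z i) (k i) V :=
    fun u _ V => fun177_gaugeAct bg M₁ (hk i) u (h181 i u) V
  obtain ⟨D, hD⟩ := hF i Vk hR B hB
  exact isCriticalPt_iff_of_hasDerivAt hT hv hf (ext i Vk) (hB.trans (hr2 i)) hD (fun δ => hA i Vk hR B δ hB)

/-- ★★ **THE LOCAL ENDPOINT — LOCAL twin of `B15Prop1ChartRecentering.exists_domain_prop1Printed_lfVarOn_std_su2_box_of_differentiableAt`**: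
`∃ a₁ > 0, B15.Prop1Printed (lfVarOn su2Chart (InstOn.std …))` from letters asked ONLY at `eR`-regular boundary data and, for the
first-variation ∕ differentiability letters `hA` ∕ `hG` about print's function `B′ ↦ A(U_{k,Z}(exp(iB′)Ṽ_k))`, only on the ball `‖B′‖ ≤ r`.
[cite: Balaban1989LargeFieldI, Prop. 1 (1.77)–(1.78) p.194, p.193; Balaban1989LargeFieldII, pp.357–359, (1.12); Balaban1985Variational,
Prop. 4 pp.292–293, (181) p.307, (190) p.308] -/
theorem exists_domain_prop1Printed_lfVarOn_std_su2_box_of_differentiableAt_local (hd3 : 3 ≤ P.d) (h0 : 0 < P.d) {ι : Type}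
    {av : ∀ j, Averaging P j SU2}
    (bg : DetBackground P SU2 av) (M₁ : ℕ) (Z Λ : ι → Set (Site P 0)) (k : ι → ℕ) (M : ι → ℝ)
    (An : ∀ i, ℝ → GaugeField P (k i) SU2 → Prop) (hk : ∀ i, k i ≤ P.m + P.K)
    (Rg : ∀ i, GaugeField P (k i) SU2 → Prop)
    (h181 : ∀ i (u : GaugeTransf P (k i) SU2), Cov181 bg (Bj M₁ (Z i) (k i)) (blockLift (k i) u))
    (T : ∀ i, Finset (PBond P (k i)))
    {F : ι → Type*} [∀ i, NormedAddCommGroup (F i)] [∀ i, InnerProductSpace ℝ (F i)] [∀ i, FiniteDimensional ℝ (F i)]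
    (H : ∀ i, GaugeField P (k i) SU2 →
      (GaugeSlice (pts (k i) (Λ i)) (T i) (EuclideanSpace ℝ (Fin 3)) →ₗ[ℝ] F i))
    (Δ₁ : ∀ i, GaugeField P (k i) SU2 → (F i →ₗ[ℝ] F i)) (dV : ∀ i, GaugeField P (k i) SU2 → F i → F i)
    {Fc : ι → Type*} [∀ i, NormedAddCommGroup (Fc i)] [∀ i, NormedSpace ℂ (Fc i)] (emb : ∀ i, F i → Fc i)
    (hemb : ∀ i (u v : F i), ‖emb i u - emb i v‖ = ‖u - v‖) (hemb0 : ∀ i, emb i 0 = 0)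
    (W : ∀ i, GaugeField P (k i) SU2 → Fc i → Fc i) {C₄ a₃ a : ι → ℝ} (hC₄ : ∀ i, 0 ≤ C₄ i) (ha : ∀ i, 0 < a i)
    (hW : ∀ i Vk, Rg i Vk → Prop4Hyp (W i Vk) (C₄ i) (a₃ i)) (hWdV : ∀ i Vk (u : F i), W i Vk (emb i u) = emb i (dV i Vk u))
    (J : ∀ i, GaugeField P (k i) SU2 → F i)
    (lo hi : ι → Fin P.d → ℤ) (n : ι → ℕ) (hn : ∀ i κ, hi i κ ≤ lo i κ + n i) (hN : ∀ i, n i + 2 < P.sitesPerDir (k i))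
    (hbox : ∀ i, pts (k i) (Λ i) = (castSite '' Set.Icc (lo i) (hi i) : Set (Site P (k i))))
    (hZ : ∀ i, (boxPlaqs (lo i - 1) (hi i + 1) : Set (Plaq P (k i))) ⊆ plaqsInside (pts (k i) (Z i)))
    (hTG0 : ∀ i, T i = (box (fun κ => (hi i κ - lo i κ + 1).toNat) (lo i)).image fun x =>
      (⟨castSite (x - unitVec ⟨0, h0⟩), ⟨0, h0⟩⟩ : PBond P (k i)))
    (hN5 : ∀ i κ, ((hi i κ - lo i κ + 1).toNat : ℤ) + 5 < P.sitesPerDir (k i))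
    (K : ι → ℕ) (hK1 : ∀ i, 1 ≤ K i) (hKn : ∀ i κ, (hi i κ - lo i κ + 1).toNat ≤ K i)
    (ext : ∀ i, GaugeField P (k i) SU2 → GaugeField P (k i) SU2)
    (hext : ∀ i Vk, ext i Vk = extend (pts (k i) (Λ i)) (shellGauge Vk (lo i) (hi i)) Vk)
    (hlohi : ∀ i, lo i ≤ hi i)
    {γ h₁ cJ bx : ℝ} (hγ : 0 < γ) (hh₁ : 0 ≤ h₁) (hcJ : 0 ≤ cJ) (hbx : 0 ≤ bx)
    (hbxM : ∀ i, 12 * (P.d : ℝ) * ((n i : ℝ) + 2) ^ 2 ≤ bx * (M i) ^ 2)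
    {ρ r eA Cerr eR : ι → ℝ} (hr : ∀ i, 0 < r i) (heA : ∀ i, 0 < eA i) (hM : ∀ i, 1 ≤ (M i))
    (heR : ∀ i, 0 < eR i)
    (hRg : ∀ i ε Vk, 0 < ε → ε ≤ eR i → PlaqSmallOn (plaqsInside (pts (k i) (Z i ∩ (Λ i)ᶜ))) ε Vk → Rg i Vk)
    (n' : ι → ℕ) (hn' : ∀ i, 1 ≤ n' i)
    (hlead : ∀ i Vk, Rg i Vk → ∀ X : GaugeSlice (pts (k i) (Λ i)) (T i) (EuclideanSpace ℝ (Fin 3)),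
      |⟪H i Vk X, Δ₁ i Vk (H i Vk X)⟫ -
          ∑ a : Fin 3, formDk (n' i) (fun _ : Fin P.d => P.sitesPerDir (k i))
            (ofRealCfg (fun _ : Fin P.d => P.sitesPerDir (k i)) fun j =>
              ιA (pts (k i) (Λ i)) (T i) X ⟨j.1, j.2⟩ a)| ≤ Cerr i * ‖X‖ ^ 2)
    (hsm : ∀ i, Cerr i ≤ (4 / Real.pi ^ 2) ^ (P.d + 2) / (2 * (3 * (K i : ℝ) ^ 2 + 2 * (K i : ℝ) ^ 4)))
    (hγle : ∀ i, γ / (M i) ^ 5 ≤ (4 / Real.pi ^ 2) ^ (P.d + 2) / (2 * (3 * (K i : ℝ) ^ 2 + 2 * (K i : ℝ) ^ 4)))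
    (hH : ∀ i Vk, Rg i Vk → ∀ x, ‖H i Vk x‖ ≤ h₁ * ‖x‖)
    (hρ : ∀ i, h₁ * r i ≤ ρ i) (ha₃ : ∀ i, 2 * (ρ i + a i) ≤ a₃ i)
    (hsmall : ∀ i, (M i) ^ 5 / γ * h₁ * (4 * C₄ i * (ρ i + a i)) * h₁ ≤ 1 / 2)
    (hA : ∀ i Vk, Rg i Vk → ∀ X δ : GaugeSlice (pts (k i) (Λ i)) (T i) (EuclideanSpace ℝ (Fin 3)), ‖X‖ ≤ r i →
      HasDerivAt (fun s : ℝ => (fun177std bg M₁ (Z i) (k i)) (expMul su2Chart (ιA (pts (k i) (Λ i)) (T i) (X + s • δ)) (ext i Vk)))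
      (⟪H i Vk δ, J i Vk⟫ + ⟪H i Vk δ, Δ₁ i Vk (H i Vk X)⟫ + ⟪H i Vk δ, dV i Vk (H i Vk X)⟫) 0)
    (hJ : ∀ i ε Vk, 0 < ε → PlaqSmallOn (plaqsInside (pts (k i) (Z i ∩ (Λ i)ᶜ))) ε Vk → ‖J i Vk‖ ≤ cJ * ε)
    -- (c3) and `hF` DERIVED; the differentiability letter is about print's function of `B′`, at the chart points of the ball
    (hG : ∀ i Vk, Rg i Vk → ∀ B : GaugeSlice (pts (k i) (Λ i)) (T i) (EuclideanSpace ℝ (Fin 3)), ‖B‖ ≤ r i →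
      DifferentiableAt ℝ (fun B' : VecField P (k i) (EuclideanSpace ℝ (Fin 3)) =>
        (fun177std bg M₁ (Z i) (k i)) (expMul su2Chart B' (ext i Vk))) (ιA (pts (k i) (Λ i)) (T i) B))
    (hr2 : ∀ i, r i ≤ 1 / 2)
    (hAn : ∀ i ε Vk, 0 < ε → ε ≤ eA i → PlaqSmallOn (plaqsInside (pts (k i) (Z i ∩ (Λ i)ᶜ))) ε Vk → An i ε Vk)
    : ∃ a₁ : ι → ℝ, (∀ i, 0 < a₁ i) ∧
      B15.Prop1Printed (lfVarOn su2Chart fun i => InstOn.std bg M₁ (Z i) (Λ i) (k i) (M i) (a₁ i) (An i)) := by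
  refine exists_domain_prop1Printed_lfVarOn_std_su2_box_of_fderiv_local hd3 h0 bg M₁ Z Λ k M An hk Rg h181 T H Δ₁ dV emb hemb hemb0
    W hC₄ ha hW hWdV J lo hi n hn hN hbox hZ hTG0 hN5 K hK1 hKn ext hext hlohi hγ hh₁ hcJ hbx hbxM hr heA hM heR hRg n' hn' hlead hsm
    hγle hH hρ ha₃ hsmall hA hJ (fun i Vk hR B hB => ?_) hr2 hAn
  have hX : ∀ b, ‖ιA (pts (k i) (Λ i)) (T i) B b‖ < π := fun b =>
    (norm_ιA_apply_le B b).trans_lt (hB.trans_lt ((hr2 i).trans_lt (by linarith [Real.pi_gt_three])))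
  exact exists_hasFDerivAt_of_differentiableAt _ (ext i Vk) hX (hG i Vk hR B hB)

/-- ★★★ **THE LOCAL ENDPOINT AT PRINT'S REGULARITY** — `exists_domain_prop1Printed_lfVarOn_std_su2_box_of_differentiableAt_local` with the regularity
predicate INSTANTIATED by print's *«|V_k(∂p′) − 1| < ε for p′ ⊂ Z ∩ Λᶜ»* at the scale `eR i` (`Rg i Vk := PlaqSmallOn (plaqsInside (Z ∩ Λᶜ)^{(k)}) (eR i)
Vk`; the bridge by monotonicity of `<`): every per-`V_k` datum letter (`hlead`, `hH`, `hW`, `hA`, `hG`) is now asked only for `eR`-regular boundary data,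
and `hA`∕`hG` only on the ball `‖B′‖ ≤ r ≤ 1/2` — the interface NODE 00's objects can meet. [cite: Balaban1989LargeFieldI, Prop. 1 (1.77)–(1.78)
p.194, p.193; Balaban1989LargeFieldII, pp.357–359, (1.12); Balaban1985Variational, Prop. 4 pp.292–293, (181) p.307, (190) p.308] -/
theorem exists_domain_prop1Printed_lfVarOn_std_su2_box_regular (hd3 : 3 ≤ P.d) (h0 : 0 < P.d) {ι : Type}
    {av : ∀ j, Averaging P j SU2}
    (bg : DetBackground P SU2 av) (M₁ : ℕ) (Z Λ : ι → Set (Site P 0)) (k : ι → ℕ) (M : ι → ℝ)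
    (An : ∀ i, ℝ → GaugeField P (k i) SU2 → Prop) (hk : ∀ i, k i ≤ P.m + P.K)
    (eR : ι → ℝ) (heR : ∀ i, 0 < eR i)
    (h181 : ∀ i (u : GaugeTransf P (k i) SU2), Cov181 bg (Bj M₁ (Z i) (k i)) (blockLift (k i) u))
    (T : ∀ i, Finset (PBond P (k i)))
    {F : ι → Type*} [∀ i, NormedAddCommGroup (F i)] [∀ i, InnerProductSpace ℝ (F i)] [∀ i, FiniteDimensional ℝ (F i)]
    (H : ∀ i, GaugeField P (k i) SU2 →
      (GaugeSlice (pts (k i) (Λ i)) (T i) (EuclideanSpace ℝ (Fin 3)) →ₗ[ℝ] F i))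
    (Δ₁ : ∀ i, GaugeField P (k i) SU2 → (F i →ₗ[ℝ] F i)) (dV : ∀ i, GaugeField P (k i) SU2 → F i → F i)
    {Fc : ι → Type*} [∀ i, NormedAddCommGroup (Fc i)] [∀ i, NormedSpace ℂ (Fc i)] (emb : ∀ i, F i → Fc i)
    (hemb : ∀ i (u v : F i), ‖emb i u - emb i v‖ = ‖u - v‖) (hemb0 : ∀ i, emb i 0 = 0)
    (W : ∀ i, GaugeField P (k i) SU2 → Fc i → Fc i) {C₄ a₃ a : ι → ℝ} (hC₄ : ∀ i, 0 ≤ C₄ i) (ha : ∀ i, 0 < a i)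
    (hW : ∀ i Vk, PlaqSmallOn (plaqsInside (pts (k i) (Z i ∩ (Λ i)ᶜ))) (eR i) Vk → Prop4Hyp (W i Vk) (C₄ i) (a₃ i)) (hWdV : ∀ i Vk (u : F i), W i Vk (emb i u) = emb i (dV i Vk u))
    (J : ∀ i, GaugeField P (k i) SU2 → F i)
    (lo hi : ι → Fin P.d → ℤ) (n : ι → ℕ) (hn : ∀ i κ, hi i κ ≤ lo i κ + n i) (hN : ∀ i, n i + 2 < P.sitesPerDir (k i))
    (hbox : ∀ i, pts (k i) (Λ i) = (castSite '' Set.Icc (lo i) (hi i) : Set (Site P (k i))))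
    (hZ : ∀ i, (boxPlaqs (lo i - 1) (hi i + 1) : Set (Plaq P (k i))) ⊆ plaqsInside (pts (k i) (Z i)))
    (hTG0 : ∀ i, T i = (box (fun κ => (hi i κ - lo i κ + 1).toNat) (lo i)).image fun x =>
      (⟨castSite (x - unitVec ⟨0, h0⟩), ⟨0, h0⟩⟩ : PBond P (k i)))
    (hN5 : ∀ i κ, ((hi i κ - lo i κ + 1).toNat : ℤ) + 5 < P.sitesPerDir (k i))
    (K : ι → ℕ) (hK1 : ∀ i, 1 ≤ K i) (hKn : ∀ i κ, (hi i κ - lo i κ + 1).toNat ≤ K i)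
    (ext : ∀ i, GaugeField P (k i) SU2 → GaugeField P (k i) SU2)
    (hext : ∀ i Vk, ext i Vk = extend (pts (k i) (Λ i)) (shellGauge Vk (lo i) (hi i)) Vk)
    (hlohi : ∀ i, lo i ≤ hi i)
    {γ h₁ cJ bx : ℝ} (hγ : 0 < γ) (hh₁ : 0 ≤ h₁) (hcJ : 0 ≤ cJ) (hbx : 0 ≤ bx)
    (hbxM : ∀ i, 12 * (P.d : ℝ) * ((n i : ℝ) + 2) ^ 2 ≤ bx * (M i) ^ 2)
    {ρ r eA Cerr : ι → ℝ} (hr : ∀ i, 0 < r i) (heA : ∀ i, 0 < eA i) (hM : ∀ i, 1 ≤ (M i))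
    (n' : ι → ℕ) (hn' : ∀ i, 1 ≤ n' i)
    (hlead : ∀ i Vk, PlaqSmallOn (plaqsInside (pts (k i) (Z i ∩ (Λ i)ᶜ))) (eR i) Vk → ∀ X : GaugeSlice (pts (k i) (Λ i)) (T i) (EuclideanSpace ℝ (Fin 3)),
      |⟪H i Vk X, Δ₁ i Vk (H i Vk X)⟫ -
          ∑ a : Fin 3, formDk (n' i) (fun _ : Fin P.d => P.sitesPerDir (k i))
            (ofRealCfg (fun _ : Fin P.d => P.sitesPerDir (k i)) fun j =>
              ιA (pts (k i) (Λ i)) (T i) X ⟨j.1, j.2⟩ a)| ≤ Cerr i * ‖X‖ ^ 2)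
    (hsm : ∀ i, Cerr i ≤ (4 / Real.pi ^ 2) ^ (P.d + 2) / (2 * (3 * (K i : ℝ) ^ 2 + 2 * (K i : ℝ) ^ 4)))
    (hγle : ∀ i, γ / (M i) ^ 5 ≤ (4 / Real.pi ^ 2) ^ (P.d + 2) / (2 * (3 * (K i : ℝ) ^ 2 + 2 * (K i : ℝ) ^ 4)))
    (hH : ∀ i Vk, PlaqSmallOn (plaqsInside (pts (k i) (Z i ∩ (Λ i)ᶜ))) (eR i) Vk → ∀ x, ‖H i Vk x‖ ≤ h₁ * ‖x‖)
    (hρ : ∀ i, h₁ * r i ≤ ρ i) (ha₃ : ∀ i, 2 * (ρ i + a i) ≤ a₃ i)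
    (hsmall : ∀ i, (M i) ^ 5 / γ * h₁ * (4 * C₄ i * (ρ i + a i)) * h₁ ≤ 1 / 2)
    (hA : ∀ i Vk, PlaqSmallOn (plaqsInside (pts (k i) (Z i ∩ (Λ i)ᶜ))) (eR i) Vk → ∀ X δ : GaugeSlice (pts (k i) (Λ i)) (T i) (EuclideanSpace ℝ (Fin 3)), ‖X‖ ≤ r i →
      HasDerivAt (fun s : ℝ => (fun177std bg M₁ (Z i) (k i)) (expMul su2Chart (ιA (pts (k i) (Λ i)) (T i) (X + s • δ)) (ext i Vk)))
      (⟪H i Vk δ, J i Vk⟫ + ⟪H i Vk δ, Δ₁ i Vk (H i Vk X)⟫ + ⟪H i Vk δ, dV i Vk (H i Vk X)⟫) 0)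
    (hJ : ∀ i ε Vk, 0 < ε → PlaqSmallOn (plaqsInside (pts (k i) (Z i ∩ (Λ i)ᶜ))) ε Vk → ‖J i Vk‖ ≤ cJ * ε)
    -- (c3) and `hF` DERIVED; the differentiability letter is about print's function of `B′`, at the chart points of the ball
    (hG : ∀ i Vk, PlaqSmallOn (plaqsInside (pts (k i) (Z i ∩ (Λ i)ᶜ))) (eR i) Vk → ∀ B : GaugeSlice (pts (k i) (Λ i)) (T i) (EuclideanSpace ℝ (Fin 3)), ‖B‖ ≤ r i →
      DifferentiableAt ℝ (fun B' : VecField P (k i) (EuclideanSpace ℝ (Fin 3)) =>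
        (fun177std bg M₁ (Z i) (k i)) (expMul su2Chart B' (ext i Vk))) (ιA (pts (k i) (Λ i)) (T i) B))
    (hr2 : ∀ i, r i ≤ 1 / 2)
    (hAn : ∀ i ε Vk, 0 < ε → ε ≤ eA i → PlaqSmallOn (plaqsInside (pts (k i) (Z i ∩ (Λ i)ᶜ))) ε Vk → An i ε Vk)
    : ∃ a₁ : ι → ℝ, (∀ i, 0 < a₁ i) ∧
      B15.Prop1Printed (lfVarOn su2Chart fun i => InstOn.std bg M₁ (Z i) (Λ i) (k i) (M i) (a₁ i) (An i)) :=
  exists_domain_prop1Printed_lfVarOn_std_su2_box_of_differentiableAt_local hd3 h0 bg M₁ Z Λ k M An hk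
    (fun i Vk => PlaqSmallOn (plaqsInside (pts (k i) (Z i ∩ (Λ i)ᶜ))) (eR i) Vk) h181 T H Δ₁ dV emb hemb hemb0 W hC₄ ha hW hWdV J lo
    hi n hn hN hbox hZ hTG0 hN5 K hK1 hKn ext hext hlohi hγ hh₁ hcJ hbx hbxM hr heA hM heR (fun _ _ _ _ hle hV p hp => (hV p hp).trans_le hle)
    n' hn' hlead hsm hγle hH hρ ha₃ hsmall hA hJ hG hr2 hAn

end Std

end Literature.MathematicalPhysics.QuantumFieldTheory.Balaban1983to89.B15Prop1LocalLettersRecord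

end
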